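import Literature.AnabelianGeometry.EtaleTheta.ThetaLiftUnique
import Literature.AnabelianGeometry.EtaleTheta.SettingModelKummerDataEmpty
import HarnessLib

/-!
# [EtTh] Prop. 1.5 (i)/(ii)/(iii) as typed (`ThetaSetting.Prop15i`, `Prop15ii`, `Prop15iii`): SCHEMATA over the
# Kummer / étale-theta data — kernel truth table (FACT-LIST rows F-2502, F-2503, F-0591; proof-only companion)

Mochizuki, *The étale theta function …*, Publ. RIMS **45** (2009) [EtTh], §1, Prop. 1.5 "(Theta Cohomology)",
PRIMS PDF pp. 22–23 (printed 248–249) [cite: MochizukiEtTh2009, Prop 1.5 p.23]: (i) "`F⁰/F¹ = Hom(Δ_Θ, Δ_Θ) = Ẑ·log(Θ)`,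
`F¹/F² = … = Ẑ·log(U)`, `F² = H¹(G_K, Δ_Θ) →̃ (K^×)^∧`"; (ii) the same on `Ÿ` with "`log(Ü) := ½·log(U)`"; (iii) "Any
class `η̈^Θ ∈ H¹(Π^tp_Ÿ, Δ_Θ)` arises from a unique class `η̈^Θ ∈ H¹((Π^tp_Ÿ)^Θ, Δ_Θ)` that maps to `log(Θ)` in the
quotient `F̈⁰/F̈¹` and on which `a ∈ Z` acts as follows: …".

PROOF-ONLY file (abc-iut cell, block F fact-proving wave, seat abc-iut-f-117 floating on batch-2 tranches 139/140;
FACT-LIST rows **F-2502** `Literature.AnabelianGeometry.EtaleTheta.ThetaSetting.Prop15i`, **F-2503** `….Prop15ii`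
(structures over `E : D.KummerData`, `hC : D.Compat`) and **F-0591** `….Prop15iii` (over `E : D.EtaleThetaData`,
`hC`), all kernel_closedness = parametrised).  Unlike Prop. 1.3 / Rmk. 1.3.1 (companion
`Sec1Prop13Rmk131Schema.lean`), these predicates speak about the REAL continuous `H¹` of abc-iut-L2-t1's interface,
so they have CONTENT: they constrain the interface data `log(U)`, `log(Ü)` (fields of `KummerData`, tied to each other
only by `res_logU : log(U)|_Ÿ = 2·log(Ü)`) and `η̈^Θ` (the field `etaDd` of `EtaleThetaData`, tied to nothing).
The kernel truth table, under the origin guard `IsEtThOrigin` (`Δ_Θ ≠ 1` and torsion-free, abc-iut-L2-t6/t8):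

* `logTheta_sq_ne_one` — `log(Θ)² ≠ 1` in `H¹(Δ_Θ, Δ_Θ)` (no `2`-torsion there: `Δ_Θ` centralises itself and is
  `2`-torsion-free; abc-iut-w5-d171's `h1Theta_eq_one_of_sq_eq_one_of_conj_eq`);
* **(iii), F-0591** — over ANY Kummer datum `K` the étale-theta datum with `η̈^Θ := 1` (abstract fields trivial)
  VIOLATES Prop. 1.5 (iii) as typed: `1` is then a theta class, its unique `Θ`-lift is `1` (inflation is injective,
  abc-iut-L2-t12 `inflTheta_injective`), which restricts to `1 ≠ log(Θ)` on `Δ_Θ`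
  (`KummerData.exists_etaleThetaData_not_prop15iii`; generally `not_prop15iii_of_one_mem_thetaClasses`); hence the
  EXACT REDUCTION `forall_prop15iii_iff_isEmpty_kummerData : (∀ E, Prop15iii E hC) ↔ IsEmpty D.KummerData`;
* **(i), F-2502** — if Prop. 1.5 (i) as typed holds for ONE Kummer datum `K`, it FAILS for the datum `K'` obtained by
  twisting `log(U) ↦ log(U) + 2c`, `log(Ü) ↦ log(Ü) + c|_Ÿ` (multiplicatively `·c²`, `·res c`) with `c` a lift of
  `log(Θ)` supplied by (i)'s own surjectivity `F⁰ ↠ Hom(Δ_Θ, Δ_Θ)`: `res_logU` survives and `log(U)·c² ∉ F¹` since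
  `log(Θ)² ≠ 1` (`KummerData.exists_kummerData_not_prop15i`); hence `forall_prop15i_iff_isEmpty_kummerData`;
* **(ii), F-2503** — the same twist moves `log(Ü)` out of `F̈¹` unless `K` itself already violates (ii)
  (`KummerData.exists_kummerData_not_prop15ii_of_prop15i`); hence `(∃ K, Prop15i K hC) → ∃ K, ¬ Prop15ii K hC` and
  `forall_prop15i_prop15ii_iff_isEmpty_kummerData` (a twist of `log(Ü)` alone is not available from (ii): the interface
  offers no `Y`-level class with prescribed `Ÿ`-restriction — recorded, not claimed);
* **root model** — at `ThetaSetting.model p` all three hold for every datum VACUOUSLY (`model_forall_prop15i/ii/iii`;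
  `ThetaSetting.model_isEmpty_kummerData`, abc-iut-w5-d171).

So the three rows are SCHEMATA: genuine constraints on the Kummer / étale-theta data (neither theorems of the interface
nor absurd relative to it), false as universal closures over any theta setting that carries Kummer data, vacuous at
the tree's root model.  CONSUMERS take them as HYPOTHESES (`h15 : Prop15iii E hC` in `Discharge/Sec2ThetaOrbitClasses`,
`Sec1Thm110iUniqueOfProp15iii`, `XuuCocycleOfProp15`, …; `Prop15ii` in `Thm16SubdagTransport` / `XuuCocycle*`), which is
the admissible form.  HONEST FRAMING: statements about the TYPED predicates over abstract interface data; the printed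
Prop. 1.5 is a theorem about the tempered fundamental group of a once-punctured elliptic curve and is neither asserted
nor denied; no side is taken on [IUTchIII] Cor. 3.12; typed ≠ proved.  No definitions, no instances, no Prop facts.
-/

noncomputable section

namespace Literature.AnabelianGeometry.EtaleTheta

open Literature.AnabelianGeometry.SemiGraphs

namespace ThetaSetting

variable {p : ℕ} [Fact p.Prime] {D : ThetaSetting p}

/-! ### `log(Θ)² ≠ 1` -/

variable (D) in
/-- `Δ_Θ` centralises itself inside `(Π^tp_X)^Θ` (it is commutative, root field `ker_thetaToEll_comm`).
[cite: MochizukiEtTh2009, §1 p.12] -/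
theorem deltaTheta_conj_eq_of_mem (g : D.GtpTheta) (hg : g ∈ D.DeltaTheta) (a : D.GtpTheta)
    (ha : a ∈ D.DeltaTheta) : g * a * g⁻¹ = a := by
  rw [D.ker_thetaToEll_comm g hg a ha, mul_inv_cancel_right]

/-- **`log(Θ)² ≠ 1`** in `H¹(Δ_Θ, Δ_Θ) = Hom(Δ_Θ, Δ_Θ)` under the origin guard: `H¹(Δ_Θ, Δ_Θ)` has no `2`-torsion
(trivial action, `Δ_Θ` `2`-torsion-free) and `log(Θ) ≠ 1` (`Δ_Θ ≠ 1`). [cite: MochizukiEtTh2009, Prop 1.5 (i) p.23] -/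
theorem logTheta_sq_ne_one (hO : D.IsEtThOrigin) : D.logTheta ^ 2 ≠ 1 := fun h =>
  D.logTheta_ne_one hO
    (D.h1Theta_eq_one_of_sq_eq_one_of_conj_eq hO D.DeltaTheta (D.deltaTheta_conj_eq_of_mem) _ h)

/-! ### Prop. 1.5 (iii) as typed (F-0591): `η̈^Θ` is unconstrained by the interface -/

namespace EtaleThetaData

variable (E : D.EtaleThetaData)

/-- If `1 ∈ O^×_K̈ · η̈^Θ` (e.g. `η̈^Θ := 1`), Prop. 1.5 (iii) as typed FAILS under the origin guard: the unique
`Θ`-lift of the theta class `1` is `1` (inflation is injective), which restricts to `1 ≠ log(Θ)` on `Δ_Θ`.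
[cite: MochizukiEtTh2009, Prop 1.5 (iii) p.23] -/
theorem not_prop15iii_of_one_mem_thetaClasses (hC : D.Compat) (hO : D.IsEtThOrigin)
    (h1 : (1 : D.H1 D.GtpYdd) ∈ E.thetaClasses) : ¬ Prop15iii E hC := by
  intro h
  obtain ⟨x', ⟨hinfl, hres, -⟩, -⟩ := h 1 h1
  have hx' : x' = 1 := D.inflTheta_injective D.GtpYdd (by rw [hinfl, map_one])
  -- the restriction `H¹((Π^tp_Ÿ)^Θ, Δ_Θ) → H¹(Δ_Θ, Δ_Θ)`, typed over `GtpYdd`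
  have hle : D.DeltaTheta ≤ D.GtpYdd.map D.toTheta :=
    hC.deltaTheta_le_DtpYddTheta.trans (Subgroup.map_mono inf_le_left)
  have hres' : ContH1.res (MonoidHom.id D.GtpTheta) D.DeltaTheta hle x' = D.logTheta := hres
  rw [hx', map_one] at hres'
  exact D.logTheta_ne_one hO hres'.symm

/-- `1` is a theta class iff `η̈^Θ` is (the inflation of) a Kummer class of a unit of `K̈`.
[cite: MochizukiEtTh2009, Prop 1.3 p.21] -/
theorem one_mem_thetaClasses_iff : (1 : D.H1 D.GtpYdd) ∈ E.thetaClasses ↔ E.etaDd ∈ E.kumUnitsYdd := by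
  constructor
  · rintro ⟨k, hk, h⟩
    have : E.etaDd = k⁻¹ := eq_inv_of_mul_eq_one_right h.symm
    rw [this]
    exact inv_mem hk
  · intro h
    exact ⟨E.etaDd⁻¹, inv_mem h, (inv_mul_cancel E.etaDd).symm⟩

/-- Hence Prop. 1.5 (iii) as typed EXCLUDES `η̈^Θ ∈ O^×_K̈` (Kummer classes of constants): a genuine constraint on the
free field `etaDd`. [cite: MochizukiEtTh2009, Prop 1.5 (iii) p.23] -/
theorem etaDd_not_mem_kumUnitsYdd_of_prop15iii (hC : D.Compat) (hO : D.IsEtThOrigin) (h : Prop15iii E hC) :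
    E.etaDd ∉ E.kumUnitsYdd := fun hmem =>
  E.not_prop15iii_of_one_mem_thetaClasses hC hO (E.one_mem_thetaClasses_iff.mpr hmem) h

end EtaleThetaData

namespace KummerData

variable (K : D.KummerData)

/-- **F-0591, relative countermodel**: over ANY Kummer datum, the étale-theta datum with `η̈^Θ := 1` (all abstract
`½`-groups `ℤ`, connecting maps trivial) violates Prop. 1.5 (iii) as typed, under the origin guard.
[cite: MochizukiEtTh2009, Prop 1.5 (iii) p.23] -/
theorem exists_etaleThetaData_not_prop15iii (hC : D.Compat) (hO : D.IsEtThOrigin) :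
    ∃ E : D.EtaleThetaData, E.toKummerData = K ∧ ¬ Prop15iii E hC := by
  refine ⟨{ toKummerData := K
            etaDd := 1
            H1YhalfN := fun _ => Multiplicative ℤ
            etaN := fun _ => 1
            kumN := fun _ => 1
            H1Yhalf := Multiplicative ℤ
            eta := 1
            toLevel := fun _ => 1
            kumHalf := 1
            ofIntegralY := 1
            H1YddHalf := Multiplicative ℤ
            resHalf := 1
            ofIntegral := 1
            resHalf_ofIntegralY := fun _ => rfl
            H1ZddN := fun _ => Multiplicative ℤ
            resZN := fun _ => 1 }, rfl, ?_⟩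
  exact EtaleThetaData.not_prop15iii_of_one_mem_thetaClasses _ hC hO ⟨1, one_mem _, (one_mul _).symm⟩

end KummerData

variable (D) in
/-- **F-0591, exact reduction**: under the origin guard, Prop. 1.5 (iii) as typed holds for ALL étale-theta data over
`D` iff `D` carries NO Kummer data. [cite: MochizukiEtTh2009, Prop 1.5 (iii) p.23] -/
theorem forall_prop15iii_iff_isEmpty_kummerData (hC : D.Compat) (hO : D.IsEtThOrigin) :
    (∀ E : D.EtaleThetaData, Prop15iii E hC) ↔ IsEmpty D.KummerData := by
  refine ⟨fun h => ⟨fun K => ?_⟩, fun h E => (h.false E.toKummerData).elim⟩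
  obtain ⟨E, -, hE⟩ := K.exists_etaleThetaData_not_prop15iii hC hO
  exact hE (h E)

variable (D) in
/-- Dually: some étale-theta datum violates Prop. 1.5 (iii) as typed iff `D` carries Kummer data.
[cite: MochizukiEtTh2009, Prop 1.5 (iii) p.23] -/
theorem exists_not_prop15iii_iff_nonempty_kummerData (hC : D.Compat) (hO : D.IsEtThOrigin) :
    (∃ E : D.EtaleThetaData, ¬ Prop15iii E hC) ↔ Nonempty D.KummerData := by
  refine ⟨fun ⟨E, _⟩ => ⟨E.toKummerData⟩, fun ⟨K⟩ => ?_⟩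
  obtain ⟨E, -, hE⟩ := K.exists_etaleThetaData_not_prop15iii hC hO
  exact ⟨E, hE⟩

/-! ### Prop. 1.5 (i) as typed (F-2502): `log(U)` is constrained -/

namespace KummerData

variable (K : D.KummerData)

/-- **F-2502, relative countermodel**: if Prop. 1.5 (i) as typed holds for the Kummer datum `K`, then it FAILS for
the datum obtained from `K` by the twist `log(U) ↦ log(U)·c²`, `log(Ü) ↦ log(Ü)·c|_Ÿ`, where `c` lifts `log(Θ)`
(supplied by (i)'s surjectivity): the twist respects `log(U)|_Ÿ = 2·log(Ü)`, and `log(U)·c² ∈ F¹` would force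
`log(Θ)² = 1`. [cite: MochizukiEtTh2009, Prop 1.5 (i) p.23] -/
theorem exists_kummerData_not_prop15i (hC : D.Compat) (hO : D.IsEtThOrigin) (h : Prop15i K hC) :
    ∃ K' : D.KummerData, ¬ Prop15i K' hC := by
  obtain ⟨c, hc⟩ := h.res_deltaTheta_surjective D.logTheta
  refine ⟨{ K with
            logU := K.logU * c ^ 2
            logUdd := K.logUdd * ContH1.res (MonoidHom.id D.GtpTheta) D.DeltaTheta D.GtpYddTheta_le c
            res_logU := by rw [map_mul, map_pow, K.res_logU, mul_pow] }, fun h' => ?_⟩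
  have h1 := h'.logU_mem_F1
  have h0 := h.logU_mem_F1
  simp only [F1, MonoidHom.mem_ker] at h1 h0
  rw [map_mul, h0, one_mul, map_pow, hc] at h1
  exact D.logTheta_sq_ne_one hO h1

/-- **F-2503, relative countermodel (from (i))**: if Prop. 1.5 (i) as typed holds for `K`, then Prop. 1.5 (ii) as
typed FAILS for `K` itself or for its twist by a lift `c` of `log(Θ)` — the twisted `log(Ü)·c|_Ÿ` restricts to
`log(Ü)|_{Δ_Θ} · log(Θ)` on `Δ_Θ`, which is `log(Θ) ≠ 1` when `log(Ü) ∈ F̈¹`. [cite: MochizukiEtTh2009, Prop 1.5 (ii) p.23] -/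
theorem exists_kummerData_not_prop15ii_of_prop15i (hC : D.Compat) (hO : D.IsEtThOrigin) (h : Prop15i K hC) :
    ∃ K' : D.KummerData, ¬ Prop15ii K' hC := by
  by_cases h2 : Prop15ii K hC
  swap
  · exact ⟨K, h2⟩
  obtain ⟨c, hc⟩ := h.res_deltaTheta_surjective D.logTheta
  refine ⟨{ K with
            logU := K.logU * c ^ 2
            logUdd := K.logUdd * ContH1.res (MonoidHom.id D.GtpTheta) D.DeltaTheta D.GtpYddTheta_le c
            res_logU := by rw [map_mul, map_pow, K.res_logU, mul_pow] }, fun h' => ?_⟩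
  -- the restriction `H¹((Π^tp_Ÿ)^Θ, Δ_Θ) → H¹(Δ_Θ, Δ_Θ)`, typed over `GtpYdd`
  have hle : D.DeltaTheta ≤ D.GtpYdd.map D.toTheta :=
    hC.deltaTheta_le_DtpYddTheta.trans (Subgroup.map_mono inf_le_left)
  have h1 : ContH1.res (MonoidHom.id D.GtpTheta) D.DeltaTheta hle
      (K.logUdd * ContH1.res (MonoidHom.id D.GtpTheta) D.DeltaTheta D.GtpYddTheta_le c) = 1 :=
    MonoidHom.mem_ker.mp h'.logUdd_mem_Fdd1
  have h0 : ContH1.res (MonoidHom.id D.GtpTheta) D.DeltaTheta hle K.logUdd = 1 :=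
    MonoidHom.mem_ker.mp h2.logUdd_mem_Fdd1
  rw [map_mul, h0, one_mul, ContH1.res_res] at h1
  exact D.logTheta_ne_one hO (hc.symm.trans h1)

end KummerData

variable (D) in
/-- **F-2502, exact reduction**: under the origin guard, Prop. 1.5 (i) as typed holds for ALL Kummer data over `D`
iff `D` carries NO Kummer data. [cite: MochizukiEtTh2009, Prop 1.5 (i) p.23] -/
theorem forall_prop15i_iff_isEmpty_kummerData (hC : D.Compat) (hO : D.IsEtThOrigin) :
    (∀ K : D.KummerData, Prop15i K hC) ↔ IsEmpty D.KummerData := by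
  refine ⟨fun h => ⟨fun K => ?_⟩, fun h K => (h.false K).elim⟩
  obtain ⟨K', hK'⟩ := K.exists_kummerData_not_prop15i hC hO (h K)
  exact hK' (h K')

variable (D) in
/-- **F-2503 with F-2502**: under the origin guard, if ONE Kummer datum satisfies Prop. 1.5 (i) as typed then SOME
Kummer datum violates Prop. 1.5 (ii) as typed. [cite: MochizukiEtTh2009, Prop 1.5 (ii) p.23] -/
theorem exists_not_prop15ii_of_exists_prop15i (hC : D.Compat) (hO : D.IsEtThOrigin)
    (h : ∃ K : D.KummerData, Prop15i K hC) : ∃ K : D.KummerData, ¬ Prop15ii K hC := by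
  obtain ⟨K, hK⟩ := h
  exact K.exists_kummerData_not_prop15ii_of_prop15i hC hO hK

variable (D) in
/-- **F-2502 ∧ F-2503, exact reduction**: under the origin guard, Prop. 1.5 (i) and (ii) as typed hold for ALL
Kummer data over `D` iff `D` carries NO Kummer data. [cite: MochizukiEtTh2009, Prop 1.5 (ii) p.23] -/
theorem forall_prop15i_prop15ii_iff_isEmpty_kummerData (hC : D.Compat) (hO : D.IsEtThOrigin) :
    (∀ K : D.KummerData, Prop15i K hC ∧ Prop15ii K hC) ↔ IsEmpty D.KummerData :=
  ⟨fun h => (D.forall_prop15i_iff_isEmpty_kummerData hC hO).mp fun K => (h K).1,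
    fun h K => (h.false K).elim⟩

/-- The (i) clause "`F⁰ ↠ Hom(Δ_Θ, Δ_Θ)`" is a property of the SETTING alone (no Kummer field occurs in it): it
holds as soon as Prop. 1.5 (i) as typed holds for SOME Kummer datum. [cite: MochizukiEtTh2009, Prop 1.5 (i) p.23] -/
theorem res_deltaTheta_surjective_of_exists_prop15i (hC : D.Compat) (h : ∃ K : D.KummerData, Prop15i K hC) :
    Function.Surjective
      (ContH1.res (MonoidHom.id D.GtpTheta) D.DeltaTheta
        (hC.deltaTheta_le_DtpYTheta.trans (Subgroup.map_mono inf_le_left)) :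
        D.H1Theta (D.GtpY.map D.toTheta) → D.H1Theta D.DeltaTheta) := by
  obtain ⟨K, hK⟩ := h
  exact hK.res_deltaTheta_surjective

/-! ### Universal closures over everything -/

/-- **F-0591, the universal closure** (guarded): Prop. 1.5 (iii) as typed holds for all primes, all theta settings
at an [EtTh] origin with `Compat`, and all étale-theta data iff no such setting carries Kummer data.
[cite: MochizukiEtTh2009, Prop 1.5 (iii) p.23] -/
theorem forall_prop15iii_iff_forall_isEmpty_kummerData :
    (∀ (p : ℕ) [Fact p.Prime] (D : ThetaSetting p) (hC : D.Compat) (_ : D.IsEtThOrigin) (E : D.EtaleThetaData),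
        Prop15iii E hC) ↔
      ∀ (p : ℕ) [Fact p.Prime] (D : ThetaSetting p), D.Compat → D.IsEtThOrigin → IsEmpty D.KummerData :=
  ⟨fun h p _ D hC hO => (D.forall_prop15iii_iff_isEmpty_kummerData hC hO).mp (h p D hC hO),
    fun h p _ D hC hO => (D.forall_prop15iii_iff_isEmpty_kummerData hC hO).mpr (h p D hC hO)⟩

/-- **F-2502, the universal closure** (guarded): Prop. 1.5 (i) as typed holds for all primes, all theta settings at
an [EtTh] origin with `Compat`, and all Kummer data iff no such setting carries Kummer data.
[cite: MochizukiEtTh2009, Prop 1.5 (i) p.23] -/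
theorem forall_prop15i_iff_forall_isEmpty_kummerData :
    (∀ (p : ℕ) [Fact p.Prime] (D : ThetaSetting p) (hC : D.Compat) (_ : D.IsEtThOrigin) (K : D.KummerData),
        Prop15i K hC) ↔
      ∀ (p : ℕ) [Fact p.Prime] (D : ThetaSetting p), D.Compat → D.IsEtThOrigin → IsEmpty D.KummerData :=
  ⟨fun h p _ D hC hO => (D.forall_prop15i_iff_isEmpty_kummerData hC hO).mp (h p D hC hO),
    fun h p _ D hC hO => (D.forall_prop15i_iff_isEmpty_kummerData hC hO).mpr (h p D hC hO)⟩

/-! ### The tree's root model: all three closures hold vacuously -/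

/-- At the root model Prop. 1.5 (i) as typed holds for every Kummer datum — vacuously (there is none).
[cite: MochizukiEtTh2009, Prop 1.5 (i) p.23] -/
theorem model_forall_prop15i (p : ℕ) [Fact p.Prime] (hC : (ThetaSetting.model p).Compat) :
    ∀ K : (ThetaSetting.model p).KummerData, Prop15i K hC :=
  fun K => ((ThetaSetting.model_isEmpty_kummerData p).false K).elim

/-- At the root model Prop. 1.5 (ii) as typed holds for every Kummer datum — vacuously.
[cite: MochizukiEtTh2009, Prop 1.5 (ii) p.23] -/
theorem model_forall_prop15ii (p : ℕ) [Fact p.Prime] (hC : (ThetaSetting.model p).Compat) :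
    ∀ K : (ThetaSetting.model p).KummerData, Prop15ii K hC :=
  fun K => ((ThetaSetting.model_isEmpty_kummerData p).false K).elim

/-- At the root model Prop. 1.5 (iii) as typed holds for every étale-theta datum — vacuously.
[cite: MochizukiEtTh2009, Prop 1.5 (iii) p.23] -/
theorem model_forall_prop15iii (p : ℕ) [Fact p.Prime] (hC : (ThetaSetting.model p).Compat) :
    ∀ E : (ThetaSetting.model p).EtaleThetaData, Prop15iii E hC :=
  fun E => ((ThetaSetting.model_isEmpty_etaleThetaData p).false E).elim

end ThetaSetting

end Literature.AnabelianGeometry.EtaleTheta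

end
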